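import Summits.BirchSwinnertonDyer.BirchSwinnertonDyer.Theses.PAdicOrder
import Summits.BirchSwinnertonDyer.BirchSwinnertonDyer.Theses.PAdicOrderV2
import Literature.NumberTheory.EllipticCurves.CanonicalPAdicHeight
import Summits.BirchSwinnertonDyer.BirchSwinnertonDyer.Theorems.PAdicOrderV2PAdicOrderThesisR2StubUBRank0
import Summits.BirchSwinnertonDyer.BirchSwinnertonDyer.Theorems.PAdicOrderV2PAdicOrderThesisR2StubJetVisible
import Summits.BirchSwinnertonDyer.BirchSwinnertonDyer.Theorems.PAdicOrderV2PAdicOrderThesisR2StubPointShape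
import Summits.BirchSwinnertonDyer.BirchSwinnertonDyer.Theorems.PAdicOrderV2PAdicOrderThesisR2StubJetAssembly
import Summits.BirchSwinnertonDyer.BirchSwinnertonDyer.Theorems.PAdicOrderV2PAdicOrderThesisR2StubSigmaJet

/-!
# Line `wieferich-jet` for crux `PAdicOrderThesisR2` (stmt-BirchSwinnertonDyer-0487) — lead skeleton (seat a1)

X := `Summit.BirchSwinnertonDyer.BirchSwinnertonDyer.Theses.PAdicOrderV2.PAdicOrderThesisR2`
(∀ E/ℚ globally minimal W, ∃ good ordinary p, ∃ newform f of W: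
 ord_T L_p(f, α_p, T) = r_an(W) ∧ ord_T L_p(f, α_p, T) = r_MW(W)).

This is the crux-plan seat's checked SECTOR skeleton (`Cruxes/PAdicOrderThesisR2/SectorLineWieferichJet.lean`,
line card `Lines/wieferich-jet.md`) completed by the lead into an HONEST skeleton for X with seven registered
stubs (`stubs_max`), composition `PAdicOrderThesisR2_of` / `PAdicOrderThesisR2_proof` concluding the crux by
name in both route spellings (the item is wanted by `PAdicOrderV2` and `PAdicOrder`; byte-identical bodies).

## Why seven stubs and which are which (numbers, not hope)

Kernel-checked invariant of the dead line `Sketch` (`Lines/Sketch-dead.md` §2(c); p100810, p136391, p135275):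
X ↔ BSDgm ∧ OnePrimeComparison, X → (2 ≤ r_an → r_an ≤ r_MW), X → modularity. So EVERY skeleton for X carries
theorem-grade inputs that the tree only cites (modularity, Kato, GZK, Perrin-Riou) and the summit's open half in
analytic rank ≥ 2. This skeleton DECLARES them instead of hiding them:

* `stub_factsInPrint` (F; theorems in print, XL formalisation, stub-blocked on named Literature facts with no
  `_holds`: `ModularForms.exists_isNewformOf` (BCDT 2001), `kato_mordellWeilRank_le_order_padicLFunction` (Kato
  2004 Thm 17.4/18.4; = route item `PAdicOrderKatoSideR2`, stmt-0491), `rank_eq_analyticRank_of_analyticRank_le_one`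
  / `gross_zagier_rank_one_rat` (GZK), `perrinRiou_padicGrossZagier` + Friedberg–Hoffstein twist (PR87 over ℚ at
  one prime, Greenberg LNM 1716 §4 p. 111)) — the conjunction C1 ∧ C2 ∧ C4 ∧ PR of the card.
* `stub_higherRank` (R; BARE — declared import, no mechanism in the idea: OnePrimeUBHigherRank ∧ LBHigherRank,
  byte-for-byte the two goals at which `Sketch` died; = children C3|_{r_an ≥ 2} ∧ C5 of the strategist's split).
  A lead meets prover L5(3) at THIS stub by design; the line's claim is sector-scoped (triage r2, unanimous).
* `stub_heightNonWieferich` (NW; the transferred crux C⁺, OPEN, elementary Π₂, the card's hardest stub;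
  RESHAPED at cycle 1 to its weakest sufficient form — SOME admissible non-height-Wieferich point at SOME good
  ordinary p ≥ 5 on every curve with a point of infinite order; the card's per-point multiple-of-P form implies
  it and is equivalent to it in rank one).
* FOUR PROVABLE stubs carrying the idea's new mathematics on the tree's objects — ALL LANDED at cycle 1
  (wave 1 + lead), now imported: `stub_jetVisible_of_not_heightWieferich` (Iwasawa-log isometry on p-units;
  p143203, `…Theorems/PAdicOrderV2PAdicOrderThesisR2StubJetVisible.lean`), `stub_pointShape` (valuation shape
  of an E₁-point on an integral model: ‖x‖·‖t‖² = 1 and ‖x t² − 1 + a₁ t‖ ≤ ‖t‖², t = −x/y; p143221,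
  `…StubPointShape.lean`), `stub_sigmaJet` (‖σ_p(t) − t − (a₁/2)t²‖ ≤ ‖t‖³ from `IsMazurTateSigmaPair` +
  `two_mul_coeff_two` + `mazur_tate_sigma_existsUnique_holds`; p143282, `…StubSigmaJet.lean`),
  `stub_jetAssembly` (point shape → sigma jet → JET CONGRUENCE ‖ĥ_p(x,y) − log_p(num x)‖ ≤ p^{−v_p(den x)}, via
  `padicLog_mul_holds` and `norm_padicLogSeries_eq`; p143215, `…StubJetAssembly.lean`). The sector skeleton's
  `stub_jetCongruence` was reshaped into the three registered stubs point shape / sigma jet / assembly; the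
  jet congruence is now an unconditional tree theorem (`jetCongruence` below, by composition).

Composition (sorry-free): `onePrimeUBRankOne_of` (sector); `thesis_of_sectors` via the landed
`KatoSandwich.padicOrderThesisR2_of_sandwich` (p96594); `PAdicOrderThesisR2_of`. Open stubs after cycle 1:
F (blocked, XL literature), R (BARE, summit-hard), NW (open) — 3 sorries.

Disproof used (tree `Cruxes/PAdicOrderThesisR2/Disproof.lean`, cycle-1 FINAL): (a)/(a′) every witness prime here
carries `IsOrdinaryAt` (NW, PR inside F, R); (c) no stub is a ∀p statement about `L_p` (landed Negative p98081
not instantiated); (n) normal form honoured by F and R being explicit.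

Nothing in this file asserts a Theses decl unconditionally: the only `sorry`s are the three open `stub_*`
(F, R, NW).
-/

-- single-conjunct summit: `Summit.BirchSwinnertonDyer.BirchSwinnertonDyer.…` repeats the name by design
set_option linter.dupNamespace false

namespace Summit.BirchSwinnertonDyer.BirchSwinnertonDyer.Cruxes.PAdicOrderThesisR2.WieferichJet

open Literature.NumberTheory.EllipticCurves Literature.NumberTheory.EllipticCurves.ModularForms
open Summit.BirchSwinnertonDyer.BirchSwinnertonDyer.Theses.PAdicOrderV2

/-! ## Definitions (elementary) -/

/-- **Height-Wieferich** at `(x, p)`: `p` is a Wieferich prime to base `a = num x` AT LEVEL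
`v_p(den x)`: `a^{p-1} ≡ 1 (mod p^{v_p(den x)})` (or the degenerate `a^{p-1} = 1`). For an
admissible point `den x = d²`, `v_p(den x) = 2e ≥ 2`; for `e = 1` this is the classical Wieferich
condition `a^{p-1} ≡ 1 (mod p²)`. Pure integer arithmetic. -/
def IsHeightWieferich (p : ℕ) (x : ℚ) : Prop :=
  x.num ^ (p - 1) = 1 ∨ (padicValNat p x.den : ℤ) ≤ padicValInt p (x.num ^ (p - 1) - 1)

/-- **Jet visibility** (normed twin of `¬ IsHeightWieferich`): `p^{-v_p(den x)} < ‖log_p(num x)‖`. -/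
def IsJetVisible (p : ℕ) [Fact p.Prime] (x : ℚ) : Prop :=
  (p : ℝ) ^ (-(padicValNat p x.den : ℤ)) < ‖padicLog p ((x.num : ℚ) : ℚ_[p])‖

/-- **JET CONGRUENCE** (the lever): for `W` globally minimal, `p ≥ 5` good ordinary and an
admissible point `(x, y)`, `‖ĥ_p(x,y) − log_p(num x)‖ ≤ p^{-v_p(den x)}`. -/
def JetCongruence : Prop :=
  ∀ (W : WeierstrassCurve ℚ) [W.IsElliptic] [W.IsGloballyMinimal] (p : ℕ) [Fact p.Prime],
    5 ≤ p → IsOrdinaryAt W p →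
    ∀ {x y : ℚ} (h : W.toAffine.Nonsingular x y), W.IsAdmissible p (.some x y h) →
      ‖W.canonicalPAdicHeight p (.some x y h) - padicLog p ((x.num : ℚ) : ℚ_[p])‖
        ≤ (p : ℝ) ^ (-(padicValNat p x.den : ℤ))

/-- **Point shape** (valuations of a point of `E₁(ℚ_p)` on an integral equation, AEC VII.2.2 /
IV.1): for `W` globally minimal and `(x, y) ∈ W(ℚ)` with `‖x‖_p > 1`, writing `t = -x/y`:
`y ≠ 0`, `‖x‖·‖t‖² = 1` (`3 v(x) = 2 v(y)`), and `x t² = x³/y² ≡ 1 − a₁ t (mod t²)`, i.e.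
`‖x t² − 1 + a₁ t‖ ≤ ‖t‖²` (from the Weierstrass equation divided by `y²`). -/
def PointShape : Prop :=
  ∀ (W : WeierstrassCurve ℚ) [W.IsGloballyMinimal] (p : ℕ) [Fact p.Prime] {x y : ℚ},
    W.toAffine.Nonsingular x y → 1 < ‖(x : ℚ_[p])‖ →
      (y : ℚ_[p]) ≠ 0 ∧ ‖(x : ℚ_[p])‖ * ‖-(x : ℚ_[p]) / y‖ ^ 2 = 1 ∧
        ‖(x : ℚ_[p]) * (-(x : ℚ_[p]) / y) ^ 2 - 1 + (W.a₁ : ℚ_[p]) * (-(x : ℚ_[p]) / y)‖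
          ≤ ‖-(x : ℚ_[p]) / y‖ ^ 2

/-- **Sigma jet**: for `W` globally minimal elliptic and `p ≥ 5` good ordinary, the canonical
Mazur–Tate sigma function satisfies `σ_p(t) = t + (a₁/2) t² + O(t³)` on the open unit disc:
`‖σ_p(t) − t − (a₁/2) t²‖ ≤ ‖t‖³` (`σ_p ∈ t + (a₁/2)t² + t³ℤ_p⟦t⟧`: `IsMazurTateSigmaPair`,
`two_mul_coeff_two`, `mazur_tate_sigma_existsUnique_holds`). -/
def SigmaJet : Prop :=
  ∀ (W : WeierstrassCurve ℚ) [W.IsElliptic] [W.IsGloballyMinimal] (p : ℕ) [Fact p.Prime],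
    5 ≤ p → IsOrdinaryAt W p → ∀ (t : ℚ_[p]), ‖t‖ < 1 →
      ‖W.padicSigmaEval p t - t - (W.a₁ : ℚ_[p]) / 2 * t ^ 2‖ ≤ ‖t‖ ^ 3

/-- **Visibility criterion** (elementary, curve-free): for `p` odd and `x ∈ ℚ` with `p ∤ num x`,
not height-Wieferich ⇒ jet visible. Content: the Iwasawa logarithm is an isometry near `1`, so for
a `p`-unit integer `a`, `‖log_p a‖ = ‖(p-1)⁻¹ · L(a^{p-1})‖ = ‖a^{p-1} − 1‖ = p^{-v_p(a^{p-1} − 1)}`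
(tree: `padicLog_of_ne_zero`, `norm_padicLogSeries_eq`, PAdicHeightsLogProofs.lean). -/
def JetVisibleOfNotHeightWieferich : Prop :=
  ∀ (p : ℕ) [Fact p.Prime], p ≠ 2 → ∀ (x : ℚ), ¬ (p : ℤ) ∣ x.num →
    ¬ IsHeightWieferich p x → IsJetVisible p x

/-- **(NW) Height-non-Wieferich** — the transferred crux `C⁺`, in its WEAKEST form sufficient for
the composition (reshaped at cycle 1, wave-1 audit: the multiple-of-`P` clause of the card's (NW)
is never used): every globally minimal elliptic curve with a rational point of infinite order has,
at SOME good ordinary prime `p ≥ 5`, SOME admissible rational point `(a/d², b/d³)` with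
`a^{p-1} ≢ 1 (mod p^{v_p(d²)})`. Implied by the card's per-point (NW) (take any admissible multiple);
equivalent to it in rank one (the conclusion is invariant under `Q ↦ kQ`: `ĥ_p(kQ) = k²ĥ_p(Q)`,
`v_p(den x(kQ)) = v_p(den x(Q)) + 2v_p(k)`). OPEN (Wieferich-type Π₂ statement; per-instance
decidable). -/
def HeightNonWieferich : Prop :=
  ∀ (W : WeierstrassCurve ℚ) [W.IsElliptic] [W.IsGloballyMinimal],
    (∃ P : W.toAffine.Point, ¬ IsOfFinAddOrder P) →
    ∃ (p : ℕ) (_ : Fact p.Prime), 5 ≤ p ∧ IsOrdinaryAt W p ∧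
      ∃ (x y : ℚ) (h : W.toAffine.Nonsingular x y),
        W.IsAdmissible p (.some x y h) ∧ ¬ IsHeightWieferich p x

/-- **LB in analytic rank one** (Gross–Zagier 1986 + Kolyvagin 1990): `r_an = 1 ⇒ 1 ≤ r_MW`.
Byte-identical to child C4 `PAdicOrderLBRankOne` of the certified split / `Sketch.stub_LB_rank1`. -/
def LBRankOne : Prop :=
  ∀ (W : WeierstrassCurve ℚ) [W.IsElliptic] [W.IsGloballyMinimal],
    W.analyticRank = 1 → 1 ≤ W.mordellWeilRank

/-- **Perrin-Riou over `ℚ` at one prime** (PR87 Thm 1.3 + GZK over a Heegner field with `p` split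
and non-vanishing twist + restriction of the canonical `K`-height): for `W` of analytic rank `1`
and `p ≥ 5` good ordinary, an admissible rational point of non-zero canonical cyclotomic `p`-adic
height forces `ord_{T=0} L_p(f, α_p, T) ≤ 1` for every newform `f` of `W`. -/
def PerrinRiouRankOne : Prop :=
  ∀ (W : WeierstrassCurve ℚ) [W.IsElliptic] [W.IsGloballyMinimal], W.analyticRank = 1 →
    ∀ (p : ℕ) [Fact p.Prime], 5 ≤ p → IsOrdinaryAt W p →
    ∀ {x y : ℚ} (h : W.toAffine.Nonsingular x y), W.IsAdmissible p (.some x y h) →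
      W.canonicalPAdicHeight p (.some x y h) ≠ 0 →
    ∀ {N : ℕ} [NeZero N] (f : CuspForm (CongruenceSubgroup.Gamma0 N) 2), IsNewformOf W f →
      (padicLFunction f (unitRoot W p : ℚ_[p])).order ≤ 1

/-! ## Targets and sectors -/

/-- **Sector target** `C3|_{r_an = 1}`: one-prime `p`-adic upper bound in analytic rank one. -/
def OnePrimeUBRankOne : Prop :=
  ∀ (W : WeierstrassCurve ℚ) [W.IsElliptic] [W.IsGloballyMinimal], W.analyticRank = 1 →
    ∃ (p : ℕ) (_ : Fact p.Prime), 5 ≤ p ∧ IsOrdinaryAt W p ∧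
      ∀ {N : ℕ} [NeZero N] (f : CuspForm (CongruenceSubgroup.Gamma0 N) 2), IsNewformOf W f →
        (padicLFunction f (unitRoot W p : ℚ_[p])).order ≤ (W.analyticRank : ℕ∞)

/-- The complementary sector `C3|_{r_an ≥ 2}` (open; NOT addressed by this idea). -/
def OnePrimeUBHigherRank : Prop :=
  ∀ (W : WeierstrassCurve ℚ) [W.IsElliptic] [W.IsGloballyMinimal], 2 ≤ W.analyticRank →
    ∃ (p : ℕ) (_ : Fact p.Prime), 5 ≤ p ∧ IsOrdinaryAt W p ∧
      ∀ {N : ℕ} [NeZero N] (f : CuspForm (CongruenceSubgroup.Gamma0 N) 2), IsNewformOf W f →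
        (padicLFunction f (unitRoot W p : ℚ_[p])).order ≤ (W.analyticRank : ℕ∞)

/-- Child C3 `PAdicOrderOnePrimeUB` of the strategist's certified split (STRATEGY-CENSUS App. A;
verbatim), = `Sketch.stub_UB_pos`. -/
def PAdicOrderOnePrimeUB : Prop :=
  ∀ (W : WeierstrassCurve ℚ) [W.IsElliptic] [W.IsGloballyMinimal], 0 < W.analyticRank →
    ∃ (p : ℕ) (_ : Fact p.Prime), 5 ≤ p ∧ IsOrdinaryAt W p ∧
      ∀ {N : ℕ} [NeZero N] (f : CuspForm (CongruenceSubgroup.Gamma0 N) 2), IsNewformOf W f →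
        (padicLFunction f (unitRoot W p : ℚ_[p])).order ≤ (W.analyticRank : ℕ∞)

/-- Child C1 (modularity, inlined body of `exists_isNewformOf`; BCDT 2001). -/
def PAdicOrderModularity : Prop :=
  ∀ (W : WeierstrassCurve ℚ) [W.IsElliptic] [NeZero (W.conductorNorm ℤ)],
    ∃ f : CuspForm (CongruenceSubgroup.Gamma0 (W.conductorNorm ℤ)) 2, IsNewformOf W f

/-- Child C5 (BSD lower bound in analytic rank ≥ 2 — the summit's open half; the stub at which
`Sketch` died; kernel-checked NECESSARY for X, p100810). -/
def PAdicOrderLBHigherRank : Prop :=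
  ∀ (W : WeierstrassCurve ℚ) [W.IsElliptic] [W.IsGloballyMinimal],
    2 ≤ W.analyticRank → W.analyticRank ≤ W.mordellWeilRank

/-- **FACTS IN PRINT** (F): modularity (C1) ∧ Kato's inequality (C2 = route item
`PAdicOrderKatoSideR2`, stmt-0491) ∧ GZK in analytic rank one (C4) ∧ Perrin-Riou over `ℚ` at one
prime (PR). Four published theorems; XL formalisations; none has a `_holds` in the tree today. -/
def FactsInPrint : Prop :=
  PAdicOrderModularity ∧ PAdicOrderKatoSideR2 ∧ LBRankOne ∧ PerrinRiouRankOne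

/-- **HIGHER-RANK RESIDUAL** (R, BARE): the one-prime upper bound AND the BSD lower bound in
analytic rank ≥ 2 — the two goals at which `Sketch` died (`Lines/Sketch-dead.md` §1), necessary
for X (p100810, p135275) and not addressed by this idea (declared import, no mechanism). -/
def HigherRankResidual : Prop :=
  OnePrimeUBHigherRank ∧ PAdicOrderLBHigherRank

/-! ## Registered stubs

Every stub is stated UNFOLDED (no abbreviation of this file in its signature), so that the registered
signature is byte-for-byte the statement a prover lands under `Theorems/` (which cannot import this
workfile); the named `def`s above are definitionally equal to the corresponding blocks and are used only
in the glue. -/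

/-- Stub F (stub-blocked; XL literature): the four theorem-grade inputs — modularity (BCDT 2001),
Kato's inequality (= route item `PAdicOrderKatoSideR2`, stmt-0491), Gross–Zagier–Kolyvagin in
analytic rank one, Perrin-Riou over `ℚ` at one good ordinary prime. -/
theorem stub_factsInPrint :
    (∀ (W : WeierstrassCurve ℚ) [W.IsElliptic] [NeZero (W.conductorNorm ℤ)],
      ∃ f : CuspForm (CongruenceSubgroup.Gamma0 (W.conductorNorm ℤ)) 2, IsNewformOf W f) ∧
    PAdicOrderKatoSideR2 ∧
    (∀ (W : WeierstrassCurve ℚ) [W.IsElliptic] [W.IsGloballyMinimal],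
      W.analyticRank = 1 → 1 ≤ W.mordellWeilRank) ∧
    (∀ (W : WeierstrassCurve ℚ) [W.IsElliptic] [W.IsGloballyMinimal], W.analyticRank = 1 →
      ∀ (p : ℕ) [Fact p.Prime], 5 ≤ p → IsOrdinaryAt W p →
      ∀ {x y : ℚ} (h : W.toAffine.Nonsingular x y), W.IsAdmissible p (.some x y h) →
        W.canonicalPAdicHeight p (.some x y h) ≠ 0 →
      ∀ {N : ℕ} [NeZero N] (f : CuspForm (CongruenceSubgroup.Gamma0 N) 2), IsNewformOf W f →
        (padicLFunction f (unitRoot W p : ℚ_[p])).order ≤ 1) := by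
  sorry

/-- Stub R (BARE; open = the summit on {r_an ≥ 2}): the higher-rank residual — one-prime upper
bound AND BSD lower bound in analytic rank ≥ 2. -/
theorem stub_higherRank :
    (∀ (W : WeierstrassCurve ℚ) [W.IsElliptic] [W.IsGloballyMinimal], 2 ≤ W.analyticRank →
      ∃ (p : ℕ) (_ : Fact p.Prime), 5 ≤ p ∧ IsOrdinaryAt W p ∧
        ∀ {N : ℕ} [NeZero N] (f : CuspForm (CongruenceSubgroup.Gamma0 N) 2), IsNewformOf W f →
          (padicLFunction f (unitRoot W p : ℚ_[p])).order ≤ (W.analyticRank : ℕ∞)) ∧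
    (∀ (W : WeierstrassCurve ℚ) [W.IsElliptic] [W.IsGloballyMinimal],
      2 ≤ W.analyticRank → W.analyticRank ≤ W.mordellWeilRank) := by
  sorry

/-- Stub NW (HARDEST; open, elementary; weakest sufficient form): a globally minimal elliptic curve
with a rational point of infinite order has, at SOME good ordinary prime `p ≥ 5`, SOME admissible
rational point `(x, y)` that is not height-Wieferich
(`¬ (num x ^ (p-1) = 1 ∨ v_p(den x) ≤ v_p(num x ^ (p-1) − 1))`). -/
theorem stub_heightNonWieferich :
    ∀ (W : WeierstrassCurve ℚ) [W.IsElliptic] [W.IsGloballyMinimal],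
      (∃ P : W.toAffine.Point, ¬ IsOfFinAddOrder P) →
      ∃ (p : ℕ) (_ : Fact p.Prime), 5 ≤ p ∧ IsOrdinaryAt W p ∧
        ∃ (x y : ℚ) (h : W.toAffine.Nonsingular x y),
          W.IsAdmissible p (.some x y h) ∧
          ¬ (x.num ^ (p - 1) = 1 ∨ (padicValNat p x.den : ℤ) ≤ padicValInt p (x.num ^ (p - 1) - 1)) := by
  sorry

/-! ## Proved glue -/

/-- The registered stubs inhabit the named statements (definitional unfolding). -/
theorem factsInPrint_of_stub : FactsInPrint := stub_factsInPrint

/-- (idem) -/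
theorem higherRankResidual_of_stub : HigherRankResidual := stub_higherRank

/-- (idem) -/
theorem heightNonWieferich_of_stub : HeightNonWieferich := stub_heightNonWieferich

/-- (idem) -/
theorem jetVisibleOfNotHeightWieferich_of_stub : JetVisibleOfNotHeightWieferich :=
  stub_jetVisible_of_not_heightWieferich

/-- (idem) -/
theorem pointShape_of_stub : PointShape := stub_pointShape

/-- (idem) -/
theorem sigmaJet_of_stub : SigmaJet := stub_sigmaJet

/-- (idem) -/
theorem jetAssembly_of_stub : PointShape → SigmaJet → JetCongruence := stub_jetAssembly

/-- The one-point certificate: jet congruence + jet visibility ⇒ `ĥ_p ≠ 0`. -/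
theorem canonicalPAdicHeight_ne_zero_of_jet {W : WeierstrassCurve ℚ} {p : ℕ} [Fact p.Prime]
    {x y : ℚ} (h : W.toAffine.Nonsingular x y)
    (hJ : ‖W.canonicalPAdicHeight p (.some x y h) - padicLog p ((x.num : ℚ) : ℚ_[p])‖
        ≤ (p : ℝ) ^ (-(padicValNat p x.den : ℤ)))
    (hvis : IsJetVisible p x) :
    W.canonicalPAdicHeight p (.some x y h) ≠ 0 := by
  intro h0
  rw [h0, zero_sub, norm_neg] at hJ
  exact absurd hvis (not_lt.mpr hJ)

/-- An admissible point has `p ∤ num x`: `‖x‖_p > 1` (`SatisfiesLocalConditions`) while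
`p ∣ num x` would force `p ∤ den x` (coprimality) and hence `‖x‖_p ≤ 1` (`Padic.norm_rat_le_one`). -/
theorem not_dvd_num_of_isAdmissible {W : WeierstrassCurve ℚ} {p : ℕ} [Fact p.Prime] {x y : ℚ}
    (h : W.toAffine.Nonsingular x y) (hadm : W.IsAdmissible p (.some x y h)) :
    ¬ (p : ℤ) ∣ x.num := by
  intro hnum
  obtain ⟨hx, -, -⟩ : 1 < ‖((x : ℚ) : ℚ_[p])‖ ∧ _ ∧ _ := hadm.2
  have hden : ¬ p ∣ x.den := by
    intro hden
    have h1 : p ∣ x.num.natAbs := Int.natCast_dvd.mp hnum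
    have h2 : p ∣ Nat.gcd x.num.natAbs x.den := Nat.dvd_gcd h1 hden
    rw [x.reduced.gcd_eq_one] at h2
    exact (Fact.out : p.Prime).one_lt.ne' (Nat.dvd_one.mp h2)
  have hle : ‖((x : ℚ) : ℚ_[p])‖ ≤ 1 := Padic.norm_rat_le_one hden
  exact absurd hx (not_lt.mpr hle)

/-- **The JET CONGRUENCE, unconditionally** (cycle 1: stubs P, S, A landed): for `W` globally
minimal elliptic, `p ≥ 5` good ordinary and an admissible point `(x, y)`,
`‖ĥ_p(x, y) − log_p(num x)‖ ≤ p^{−v_p(den x)}`. -/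
theorem jetCongruence : JetCongruence := stub_jetAssembly stub_pointShape stub_sigmaJet

/-- **The one-point certificate, unconditionally**: an admissible point that is not
height-Wieferich at a good ordinary `p ≥ 5` has non-zero canonical cyclotomic `p`-adic height. -/
theorem canonicalPAdicHeight_ne_zero_of_not_isHeightWieferich {W : WeierstrassCurve ℚ}
    [W.IsElliptic] [W.IsGloballyMinimal] {p : ℕ} [Fact p.Prime] (h5 : 5 ≤ p)
    (hO : IsOrdinaryAt W p) {x y : ℚ} (h : W.toAffine.Nonsingular x y)
    (hadm : W.IsAdmissible p (.some x y h)) (hnw : ¬ IsHeightWieferich p x) :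
    W.canonicalPAdicHeight p (.some x y h) ≠ 0 :=
  canonicalPAdicHeight_ne_zero_of_jet h (jetCongruence W p h5 hO h hadm)
    (stub_jetVisible_of_not_heightWieferich p (by omega) x (not_dvd_num_of_isAdmissible h hadm) hnw)

/-- Pure algebra: an abelian group of `ℤ`-rank `≥ 1` has an element of infinite order
(local copy of `exists_not_isOfFinAddOrder_of_one_le_finrank`, `ComplexMultiplication.lean`). -/
theorem exists_not_isOfFinAddOrder_of_one_le_finrank' {M : Type*} [AddCommGroup M]
    (hr : 1 ≤ Module.finrank ℤ M) : ∃ x : M, ¬ IsOfFinAddOrder x := by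
  have hrank : Module.rank ℤ M ≠ 0 := by
    have hr' : 0 < Module.finrank ℤ M := hr
    have hlt : ((0 : ℕ) : Cardinal) < Module.rank ℤ M := Module.lt_rank_of_lt_finrank hr'
    exact ne_of_gt (by simpa using hlt)
  have hP : ¬ ∀ x : M, ∃ a : ℤ, a ≠ 0 ∧ a • x = 0 :=
    fun hall => hrank (rank_eq_zero_iff.2 hall)
  push Not at hP
  obtain ⟨P, hP⟩ := hP
  refine ⟨P, fun hfin => ?_⟩
  obtain ⟨n, hn, hnP⟩ := (isOfFinAddOrder_iff_nsmul_eq_zero).1 hfin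
  exact hP (n : ℤ) (by exact_mod_cast hn.ne') (by rwa [natCast_zsmul])

/-- A globally minimal elliptic curve with `1 ≤ r_MW` has a rational point of infinite order
(for the group law with decidable equality on `ℚ`; `mordellWeilRank` is `finrank ℤ E(ℚ)` with the
classical instance, bridged by `convert`). -/
theorem exists_not_isOfFinAddOrder_of_one_le_mordellWeilRank (W : WeierstrassCurve ℚ)
    (hr : 1 ≤ W.mordellWeilRank) : ∃ P : W.toAffine.Point, ¬ IsOfFinAddOrder P := by
  have hr' : 1 ≤ Module.finrank ℤ W.toAffine.Point := by
    unfold WeierstrassCurve.mordellWeilRank at hr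
    convert hr
  exact exists_not_isOfFinAddOrder_of_one_le_finrank' hr'

/-- **Sector composition (sorry-free): the five sector statements ⇒ `OnePrimeUBRankOne`.**
Given `W` of analytic rank 1: a non-torsion point exists (LB rank one); (NW) gives a good ordinary
`p ≥ 5` and an admissible point `(x, y)` that is not height-Wieferich; `p ∤ num x`
(`not_dvd_num_of_isAdmissible`), so it is jet-visible (V), and `ĥ_p(x, y) ≠ 0` by the jet
congruence; Perrin-Riou over `ℚ` (PR) gives `ord_T L_p(f, α_p, T) ≤ 1 = r_an` for every newform. -/
theorem onePrimeUBRankOne_of :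
    JetCongruence → JetVisibleOfNotHeightWieferich → HeightNonWieferich → LBRankOne →
      PerrinRiouRankOne → OnePrimeUBRankOne := by
  intro hJ hV hNW hLB hPR W _ _ hr
  obtain ⟨p, hp, h5, hO, x, y, h, hadm, hnw⟩ :=
    hNW W (exists_not_isOfFinAddOrder_of_one_le_mordellWeilRank W (hLB W hr))
  have hvis : IsJetVisible p x := hV p (by omega) x (not_dvd_num_of_isAdmissible h hadm) hnw
  have hne : W.canonicalPAdicHeight p (.some x y h) ≠ 0 :=
    canonicalPAdicHeight_ne_zero_of_jet h (hJ W p h5 hO h hadm) hvis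
  refine ⟨p, hp, h5, hO, fun f hf ↦ ?_⟩
  rw [hr, Nat.cast_one]
  exact hPR W hr p h5 hO h hadm hne f hf

/-- C3 from its two rank-sectors (trivial case split). -/
theorem onePrimeUB_of_sectors : OnePrimeUBRankOne → OnePrimeUBHigherRank → PAdicOrderOnePrimeUB := by
  intro h1 h2 W _ _ hpos
  rcases Nat.lt_or_ge W.analyticRank 2 with hlt | hge
  · exact h1 W (by omega)
  · exact h2 W hge

/-- X from the two rank-sectors of C3 plus C1, C2, C4, C5; glue = the landed
`KatoSandwich.padicOrderThesisR2_of_sandwich` (p96594). -/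
theorem thesis_of_sectors : PAdicOrderModularity → PAdicOrderKatoSideR2 → OnePrimeUBRankOne →
    OnePrimeUBHigherRank → LBRankOne → PAdicOrderLBHigherRank → PAdicOrderThesisR2 := by
  intro h1 h2 h3 h4 h5 h6
  exact _root_.Summit.BirchSwinnertonDyer.BirchSwinnertonDyer.Cruxes.PAdicOrderThesisR2.KatoSandwich.padicOrderThesisR2_of_sandwich
    h1 h2 (onePrimeUB_of_sectors h3 h4) h5 h6

/-- **Composition from the seven stub STATEMENTS** (implication form, for the tightness record). -/
theorem thesis_of_stubStatements : FactsInPrint → HigherRankResidual → HeightNonWieferich →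
    JetVisibleOfNotHeightWieferich → PointShape → SigmaJet → (PointShape → SigmaJet → JetCongruence) →
      PAdicOrderThesisR2 := by
  rintro ⟨hmod, hkato, hLB1, hPR⟩ ⟨hUB2, hLB2⟩ hNW hV hP hS hA
  exact thesis_of_sectors hmod hkato (onePrimeUBRankOne_of (hA hP hS) hV hNW hLB1 hPR) hUB2 hLB1 hLB2

/-- **Composition.** The crux `PAdicOrderThesisR2` (route `PAdicOrderV2` spelling) from the seven
registered stubs. -/
theorem PAdicOrderThesisR2_of : PAdicOrderThesisR2 :=
  thesis_of_stubStatements factsInPrint_of_stub higherRankResidual_of_stub heightNonWieferich_of_stub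
    jetVisibleOfNotHeightWieferich_of_stub pointShape_of_stub sigmaJet_of_stub jetAssembly_of_stub

/-- **Composition, route `PAdicOrder` spelling** (the crux item stmt-0487 is wanted by both
routes under byte-identical decls; `Iff.rfl`). -/
theorem PAdicOrderThesisR2_proof :
    Summit.BirchSwinnertonDyer.BirchSwinnertonDyer.Theses.PAdicOrder.PAdicOrderThesisR2 :=
  PAdicOrderThesisR2_of

/-! ## The definitions compute (in-Lean special cases, no `sorry`) -/

/-- MST 2006 §4.1 instance of the lever's certificate: 37a1, `p = 5`, `Q = 8P = (21/25, -69/125)`;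
`21⁴ - 1 = 5 · 38896` with `5 ∤ 38896`, so `v_5 = 1 < 2 = v_5(25)`: NOT height-Wieferich. -/
example : ¬ IsHeightWieferich 5 (21/25 : ℚ) := by
  haveI : Fact (Nat.Prime 5) := ⟨by norm_num⟩
  have hn : (21/25 : ℚ).num = 21 := by decide +kernel
  have hd : (21/25 : ℚ).den = 25 := by decide +kernel
  have h1 : padicValNat 5 25 = 2 := by
    rw [show (25 : ℕ) = 5 ^ 2 by norm_num, padicValNat.prime_pow]
  have h2 : padicValInt 5 ((21 : ℤ) ^ (5 - 1) - 1) = 1 := by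
    rw [show (21 : ℤ) ^ (5 - 1) - 1 = ((5 * 38896 : ℕ) : ℤ) by norm_num, padicValInt.of_nat,
      padicValNat.mul (by norm_num) (by norm_num), padicValNat.self (by norm_num),
      padicValNat.eq_zero_of_not_dvd (by norm_num)]
  unfold IsHeightWieferich
  rw [hn, hd, h1, h2]
  norm_num

/-- A toy height-Wieferich instance (the predicate is not vacuous): `7⁴ - 1 = 2400 = 5² · 96`, so
`x = 7/25` IS height-Wieferich at `5` (at such a prime the rational jet is silent). -/
example : IsHeightWieferich 5 (7/25 : ℚ) := by
  haveI : Fact (Nat.Prime 5) := ⟨by norm_num⟩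
  have hn : (7/25 : ℚ).num = 7 := by decide +kernel
  have hd : (7/25 : ℚ).den = 25 := by decide +kernel
  have h1 : padicValNat 5 25 = 2 := by
    rw [show (25 : ℕ) = 5 ^ 2 by norm_num, padicValNat.prime_pow]
  have h2 : padicValInt 5 ((7 : ℤ) ^ (5 - 1) - 1) = 2 := by
    rw [show (7 : ℤ) ^ (5 - 1) - 1 = ((5 ^ 2 * 96 : ℕ) : ℤ) by norm_num, padicValInt.of_nat,
      padicValNat.mul (by norm_num) (by norm_num), padicValNat.prime_pow,
      padicValNat.eq_zero_of_not_dvd (by norm_num)]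
  unfold IsHeightWieferich
  rw [hn, hd, h1, h2]
  norm_num

end Summit.BirchSwinnertonDyer.BirchSwinnertonDyer.Cruxes.PAdicOrderThesisR2.WieferichJet
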